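import Summits.QuantumFields.GaugeBoot.Certificates.SparseReducedWindow
import Summits.QuantumFields.GaugeBoot.Certificates.KZL2rpD3EntA
import Summits.QuantumFields.GaugeBoot.Certificates.KZL2rpD3EntB
import Summits.QuantumFields.GaugeBoot.Certificates.KZL2rpD3EntC
import Summits.QuantumFields.GaugeBoot.Certificates.KZL2rpD3EntD
import Summits.QuantumFields.GaugeBoot.Certificates.KZL2rpD3EntE
import Summits.QuantumFields.GaugeBoot.Certificates.KZL2rpD3EntF
import Summits.QuantumFields.GaugeBoot.Certificates.KZL2rpD3EntG
import Summits.QuantumFields.GaugeBoot.Certificates.KZL2rpD3EntH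
import Summits.QuantumFields.GaugeBoot.Certificates.KZL2rpD3EntI
import HarnessLib

/-!
# Kernel checks of the reduced problem family `KZL2rpD3`, part A: tables, dimension and row-length checks (gb_lean_emit_win 0.10.1)

HONEST FRAMING (cell `pub-gaugeboot`): certified bounds on lattice expectations at stated coupling,
gauge group, dimension and torus size; NOT a mass gap, NOT a continuum limit, NOT a string tension;
NOT Yang–Mills-summit-bearing (barriers `FixedCouplingUltralocality`, `PerturbativeInvisibility`).
Family `KZL2rpD3` (4188 variables, 40 reduced blocks of dimensions `dimL`, max 38; signature sha256
`16943a5c38da93d2d5353ec8834c2006dd0bef669f8ab80694231803427bd5ce`): WINDOW ROUTE (emitter 0.10.1, support `Certificates/SparseReducedWindow.lean`) — this module assembles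
the entry tables `EB` from the data parts and runs the two β-independent kernel checks `dimCheck` (entries outside a block's
own dimension are empty) and `rowLenCheck` (stored row `i` has ≤ `m − i` entries, so the raw-recursor sweep agrees with the
counted one). The binding interface `dim`/`ent`/`redBlock`/`redBlock_apply` is in `Certificates/KZL2rpD3Tab.lean`.
Nothing is claimed about lattice gauge theory in this file.
-/

namespace Summit.QuantumFields.GaugeBoot.Certificates.KZL2rpD3

noncomputable section

open Matrix Summit.QuantumFields.GaugeBoot.Certificates.Sparse

/-- The upper-triangular entry tables of all blocks (data parts assembled in block order). -/
def EB : List (List (List (List (ℕ × ℤ)))) := EBa0 ++ EBb0 ++ EBc0 ++ EBd0 ++ EBe0 ++ EBf0 ++ EBg0 ++ EBh0 ++ EBi0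

set_option maxHeartbeats 0 in
/-- Kernel check: entries outside each block's own dimension are empty (padding to 38×38). -/
theorem dim_chk : dimCheck EB dimL 38 40 = true := by
  decide +kernel

set_option maxHeartbeats 0 in
/-- Kernel check: stored row `i` of every block has at most `38 − i` entries. -/
theorem row_len : rowLenCheck EB 38 40 = true := by
  decide +kernel

end

end Summit.QuantumFields.GaugeBoot.Certificates.KZL2rpD3
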